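import Summits.QuantumAdvantage.QuantumAdvantage.Theorems.LinnikCubicClassGroupsDegreeOnePrimesEscapeCubicSplittingCount
import Literature.NumberTheory.NumberFields.ArithmeticEquivalenceGassmannProofs
import Mathlib.NumberTheory.NumberField.Discriminant.Different
import Mathlib.RingTheory.Frobenius
import Mathlib.FieldTheory.Galois.Basic
import HarnessLib

/-!
# The `S₄`-dictionary at a prime `p ∤ d_N`: inert primes of a quartic field from three subfields

Topic `Summits/QuantumAdvantage/QuantumAdvantage/Theorems`, cell B2b-1 (linnik-cubic), PART A (gen 8);
helper toward the crux `DegreeOnePrimesEscape` (stmt-QuantumAdvantage-11543) of route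
`LinnikCubicClassGroups`.  HONEST FRAMING: the value of this file is a THEOREM (kernel-checked
arithmetic bookkeeping) — NOT summit progress.

Let `N/ℚ` be a Galois number field with an isomorphism `ψ : Gal(N/ℚ) ≃* S₄ = Perm (Fin 4)`, and let
`K' = N^S`, `k = N^A`, `K₃ = N^D` be the fixed fields of `S = ψ⁻¹ Stab(0)` (a quartic field), `A = ψ⁻¹ A₄`
(its quadratic resolvent) and `D = ψ⁻¹ D₈` (a cubic resolvent field).  Write
`a_E(p) = #{𝔭 ∣ p in E : f(𝔭|p) = 1} = (splittingType E p).count 1`.  At every prime `p ∤ d_N`: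

  `7 ≤ 2 a_k(p) + a_{K₃}(p) + 3 a_{K'}(p) + 6·𝟙[no prime of K' above p has residue degree 1 or 2]`

(`quartic_dictionary`), and the bracket forces `p` to be INERT in the quartic field
(`isPrime_span_of_forall_finrank_lt_two_mul`: at `p ∤ d_K` residue degrees `> [K:ℚ]/2` leave room for
one prime only).  This is the finite-group inequality of `…QuarticS4Group.lean` (`exists_quartic_subgroups`)
(`168 ≤ 4 c_A + 3 c_D + 12 c_S + 144·𝟙[c_S(φ) = c_S(φ²) = 0]`) read through the Frobenius dictionary at
an unramified prime: for a prime `Q₀ ∣ p` of `N` with arithmetic Frobenius `φ` and trivial inertia,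
`|Gal(N/E)| · Σ_{𝔭 ∣ p in E, f(𝔭|p) ∣ m} f(𝔭|p) = c_{Gal(N/E)}(φ^m)` (`card_fixingSubgroup_mul_sum_filter_dvd`,
the tree's Perlis count (★) `card_inertia_mul_card_fixingSubgroup_mul_sum` at `I = 1`).

References: R. Perlis, J. Number Theory 9 (1977) §1 [Perlis1977]; D. A. Marcus, *Number Fields*, Ch. 4,
Thm. 33 [Marcus2018].
-/

noncomputable section

open scoped NumberField
open Ideal NumberField
open Literature.NumberTheory.NumberFields

namespace Summit.QuantumAdvantage.QuantumAdvantage.Theorems.DegreeOnePrimesEscape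

/-! ### A Frobenius with trivial inertia at a prime `p ∤ d_N` -/

section Frobenius

variable {N : Type*} [Field N] [NumberField N] [IsGalois ℚ N]

/-- **At a prime `p ∤ d_N` of a Galois number field there is a prime `Q₀ ∣ p` with an arithmetic
Frobenius and trivial inertia group** (`p ∤ d_N ⇔ p` unramified, Mathlib
`NumberField.not_dvd_discr_iff_isUnramifiedIn`; `|I| = e = 1`). -/
theorem exists_isArithFrobAt_of_not_dvd_discr {p : ℕ} (hp : p.Prime)
    (hd : ¬ (p : ℤ) ∣ NumberField.discr N) :
    ∃ (Q₀ : Ideal (𝓞 N)) (_ : Q₀.IsMaximal) (_ : Q₀.LiesOver (span {(p : ℤ)})),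
      (∃ φ : N ≃ₐ[ℚ] N, IsArithFrobAt ℤ φ Q₀) ∧ Q₀.inertia (N ≃ₐ[ℚ] N) = ⊥ := by
  classical
  haveI := Fact.mk hp
  haveI h𝔭max : (span {(p : ℤ)}).IsMaximal := Int.ideal_span_isMaximal_of_prime p
  have hp𝔭 : (span {(p : ℤ)}) ≠ ⊥ := by
    rw [Ne, span_singleton_eq_bot]
    exact_mod_cast hp.ne_zero
  haveI : IsGaloisGroup (N ≃ₐ[ℚ] N) ℤ (𝓞 N) := IsGaloisGroup.of_isFractionRing _ _ _ ℚ N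
  obtain ⟨Q₀, hQ₀max, hQ₀over⟩ :=
    Ideal.exists_maximal_ideal_liesOver_of_isIntegral (S := 𝓞 N) (span {(p : ℤ)})
  haveI := hQ₀max
  haveI := hQ₀over
  haveI : Finite (𝓞 N ⧸ Q₀) :=
    Ideal.finiteQuotientOfFreeOfNeBot Q₀ (ne_bot_of_liesOver_of_ne_bot hp𝔭 Q₀)
  obtain ⟨φ, hφ⟩ := IsArithFrobAt.exists_of_isInvariant ℤ (N ≃ₐ[ℚ] N) Q₀
  refine ⟨Q₀, hQ₀max, hQ₀over, ⟨φ, hφ⟩, ?_⟩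
  have hunr : Algebra.IsUnramifiedIn (𝓞 N) (span {(p : ℤ)}) :=
    (NumberField.not_dvd_discr_iff_isUnramifiedIn N (𝓞 N) (Nat.prime_iff_prime_int.mp hp)).mp hd
  apply Subgroup.eq_bot_of_card_eq
  rw [Ideal.card_inertia_eq_ramificationIdxIn (G := N ≃ₐ[ℚ] N) (span {(p : ℤ)}) Q₀,
    Ideal.ramificationIdxIn_eq_ramificationIdx (span {(p : ℤ)}) Q₀ (N ≃ₐ[ℚ] N)]
  exact Ideal.ramificationIdx_eq_one_iff.mpr (hunr Q₀ hQ₀max.isPrime hQ₀over)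

/-- **The unramified dictionary for all `m`**: if the inertia group of `Q₀ ∣ p` is trivial and `φ` is an
arithmetic Frobenius at `Q₀`, then for every intermediate field `E = N^H` and every `m`,
`|H| · Σ_{𝔭 ∣ p in E, f(𝔭|p) ∣ m} f(𝔭|p) = #{g ∈ G : g φ^m g⁻¹ ∈ H}` (`= |H| · #Fix(φ^m | G/H)`).
[cite: Perlis1977, §1 (p. 344, display (2))] -/
theorem card_fixingSubgroup_mul_sum_filter_dvd (E : IntermediateField ℚ N) {p : ℕ} (hp : p.Prime)
    (Q₀ : Ideal (𝓞 N)) [Q₀.IsMaximal] [Q₀.LiesOver (span {(p : ℤ)})] {φ : N ≃ₐ[ℚ] N}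
    (hφ : IsArithFrobAt ℤ φ Q₀) (hI : Q₀.inertia (N ≃ₐ[ℚ] N) = ⊥) (m : ℕ) :
    Nat.card E.fixingSubgroup * ((splittingType E p).filter (· ∣ m)).sum =
      Nat.card {g : N ≃ₐ[ℚ] N // g * φ ^ m * g⁻¹ ∈ E.fixingSubgroup} := by
  have h := card_inertia_mul_card_fixingSubgroup_mul_sum E hp Q₀ hφ m
  rw [hI, Subgroup.card_bot, one_mul, sum_map_ite_dvd] at h
  rw [h]
  refine Nat.card_congr
    { toFun := fun q => ⟨q.1.1, by
        have h1 : ((q.1.2 : (⊥ : Subgroup (N ≃ₐ[ℚ] N))) : N ≃ₐ[ℚ] N) = 1 :=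
          Subgroup.mem_bot.mp q.1.2.2
        have h2 := q.2
        rwa [h1, mul_one] at h2⟩
      invFun := fun g => ⟨⟨g.1, ⟨1, Subgroup.mem_bot.mpr rfl⟩⟩, by
        show g.1 * (φ ^ m * 1) * g.1⁻¹ ∈ E.fixingSubgroup
        rw [mul_one]
        exact g.2⟩
      left_inv := fun q =>
        Subtype.ext (Prod.ext rfl (Subtype.ext (Subgroup.mem_bot.mp q.1.2.2).symm))
      right_inv := fun g => rfl }

end Frobenius

/-! ### Inertness from large residue degrees -/

/-- **A prime all of whose residue degrees exceed `[K:ℚ]/2` is inert**: if `p ∤ d_K` and every prime of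
`K` above `p` has residue degree `f` with `[K:ℚ] < 2f`, then `p𝓞_K` is a prime ideal (two such primes
would give `Σ f > [K:ℚ]`; at `p ∤ d_K` the residue degrees sum to `[K:ℚ]`, so there is exactly one prime
above `p`, with `e = 1`). -/
theorem isPrime_span_of_forall_finrank_lt_two_mul {K : Type*} [Field K] [NumberField K] {p : ℕ}
    (hp : p.Prime) (hd : ¬ (p : ℤ) ∣ NumberField.discr K)
    (h : ∀ f ∈ splittingType K p, Module.finrank ℚ K < 2 * f) :
    (span {(p : 𝓞 K)}).IsPrime := by
  classical
  set nf := UniqueFactorizationMonoid.normalizedFactors (span {(p : 𝓞 K)}) with hnf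
  have hnd : nf.Nodup := nodup_normalizedFactors_of_not_dvd_discr hp hd
  have hT : splittingType K p = nf.map (fun P => P.inertiaDeg ℤ) := by
    rw [splittingType, ← hnf, Multiset.dedup_eq_self.mpr hnd]
  have hsum := sum_splittingType_eq_finrank hp hd (K := K)
  -- exactly one prime above `p`
  have hcard : Multiset.card (splittingType K p) = 1 := by
    have hne : splittingType K p ≠ 0 := by
      intro h0
      rw [h0, Multiset.sum_zero] at hsum
      exact absurd hsum.symm (Nat.pos_iff_ne_zero.mp Module.finrank_pos)
    obtain ⟨a, ha⟩ := Multiset.exists_mem_of_ne_zero hne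
    obtain ⟨T', hT'⟩ := Multiset.exists_cons_of_mem ha
    by_contra hc
    have hT'ne : T' ≠ 0 := by
      intro h0
      rw [hT', h0, Multiset.card_cons, Multiset.card_zero] at hc
      exact hc rfl
    obtain ⟨b, hb⟩ := Multiset.exists_mem_of_ne_zero hT'ne
    have hbT : b ∈ splittingType K p := by rw [hT']; exact Multiset.mem_cons_of_mem hb
    have h1 := h a ha
    have h2 := h b hbT
    have hle : a + b ≤ (splittingType K p).sum := by
      rw [hT', Multiset.sum_cons]
      exact Nat.add_le_add_left (Multiset.le_sum_of_mem hb) a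
    omega
  rw [hT, Multiset.card_map] at hcard
  obtain ⟨P, hP⟩ := Multiset.card_eq_one.mp hcard
  have hI : span {(p : 𝓞 K)} ≠ ⊥ := by
    rw [Ne, span_singleton_eq_bot]
    exact_mod_cast hp.ne_zero
  have hassoc := UniqueFactorizationMonoid.prod_normalizedFactors hI
  rw [← hnf, hP, Multiset.prod_singleton] at hassoc
  rw [← associated_iff_eq.mp hassoc]
  have hPmem : P ∈ UniqueFactorizationMonoid.normalizedFactors (span {(p : 𝓞 K)}) := by
    rw [← hnf, hP]; exact Multiset.mem_singleton_self P
  exact Ideal.isPrime_of_prime (UniqueFactorizationMonoid.prime_of_normalized_factor P hPmem)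

/-- **Quartic case**: if `[K:ℚ] = 4`, `p ∤ d_K` and no prime of `K` above `p` has residue degree
dividing `2`, then `p` is inert in `K`. -/
theorem isPrime_span_of_sum_filter_dvd_two_eq_zero {K : Type*} [Field K] [NumberField K]
    (h4 : Module.finrank ℚ K = 4) {p : ℕ} (hp : p.Prime) (hd : ¬ (p : ℤ) ∣ NumberField.discr K)
    (h0 : ((splittingType K p).filter (· ∣ 2)).sum = 0) : (span {(p : 𝓞 K)}).IsPrime := by
  refine isPrime_span_of_forall_finrank_lt_two_mul hp hd fun f hf => ?_
  rw [h4]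
  have hfpos := splittingType_pos hp hf
  have hndvd : ¬ f ∣ 2 := fun hf2 => by
    have hmem : f ∈ (splittingType K p).filter (· ∣ 2) := Multiset.mem_filter.mpr ⟨hf, hf2⟩
    have := Multiset.le_sum_of_mem hmem
    omega
  have hf1 : f ≠ 1 := fun h => hndvd (by rw [h]; exact one_dvd 2)
  have hf2 : f ≠ 2 := fun h => hndvd (by rw [h])
  omega

/-! ### The `S₄`-dictionary at a prime `p ∤ d_N` -/

section S4

variable {N : Type*} [Field N] [NumberField N] [IsGalois ℚ N]

omit [IsGalois ℚ N] in
/-- `|Gal(N/N^H)| = |H|`. -/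
theorem natCard_fixingSubgroup_fixedField (H : Subgroup (N ≃ₐ[ℚ] N)) :
    Nat.card (IntermediateField.fixedField H).fixingSubgroup = Nat.card H := by
  rw [IntermediateField.fixingSubgroup_fixedField H]

/-- **The `S₄`-dictionary for inert primes of a quartic field, at `p ∤ d_N`.** Let `A, D ≤ Gal(N/ℚ)`
have orders `12, 8`, let `K'` be an intermediate field with `|Gal(N/K')| = 6`, and assume the group
inequality `168 ≤ 4 c_A(x) + 3 c_D(x) + 12 c_S(x) + 144·𝟙[c_S(x) = c_S(x²) = 0]` for all `x`
(`S = Gal(N/K')`; supplied by `exists_quartic_subgroups` when `Gal(N/ℚ) ≅ S₄` and `K'` is a quartic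
subfield).  Then at every prime `p ∤ d_N`:
`7 ≤ 2 a_{N^A}(p) + a_{N^D}(p) + 3 a_{K'}(p) + 6·𝟙[Σ_{𝔭 ∣ p in K', f(𝔭|p) ∣ 2} f(𝔭|p) = 0]`. -/
theorem quartic_dictionary (A D : Subgroup (N ≃ₐ[ℚ] N)) (K' : IntermediateField ℚ N)
    (hA : Nat.card A = 12) (hD : Nat.card D = 8) (hS : Nat.card K'.fixingSubgroup = 6)
    (hineq : ∀ x : N ≃ₐ[ℚ] N, 168 ≤ 4 * Nat.card {g : N ≃ₐ[ℚ] N // g * x * g⁻¹ ∈ A} +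
        3 * Nat.card {g : N ≃ₐ[ℚ] N // g * x * g⁻¹ ∈ D} +
        12 * Nat.card {g : N ≃ₐ[ℚ] N // g * x * g⁻¹ ∈ K'.fixingSubgroup} +
        (if Nat.card {g : N ≃ₐ[ℚ] N // g * x * g⁻¹ ∈ K'.fixingSubgroup} = 0 ∧
            Nat.card {g : N ≃ₐ[ℚ] N // g * (x * x) * g⁻¹ ∈ K'.fixingSubgroup} = 0 then 144 else 0))
    {p : ℕ} (hp : p.Prime) (hd : ¬ (p : ℤ) ∣ NumberField.discr N) :
    7 ≤ 2 * (splittingType (IntermediateField.fixedField A) p).count 1 +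
      (splittingType (IntermediateField.fixedField D) p).count 1 +
      3 * (splittingType K' p).count 1 +
      6 * (if ((splittingType K' p).filter (· ∣ 2)).sum = 0 then 1 else 0) := by
  classical
  obtain ⟨Q₀, hQ₀max, hQ₀over, ⟨φ, hφ⟩, hI⟩ := exists_isArithFrobAt_of_not_dvd_discr (N := N) hp hd
  -- the dictionary for the three fields (`m = 1`) and for `K'` with `m = 2`
  have hk := card_fixingSubgroup_mul_count_one_splittingType (IntermediateField.fixedField A) hp Q₀ hφ hI
  have h3 := card_fixingSubgroup_mul_count_one_splittingType (IntermediateField.fixedField D) hp Q₀ hφ hI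
  have hK := card_fixingSubgroup_mul_count_one_splittingType K' hp Q₀ hφ hI
  have hK2 := card_fixingSubgroup_mul_sum_filter_dvd K' hp Q₀ hφ hI 2
  rw [natCard_fixingSubgroup_fixedField, hA] at hk
  rw [natCard_fixingSubgroup_fixedField, hD] at h3
  rw [hS] at hK hK2
  have hineq := hineq φ
  simp only [IntermediateField.fixingSubgroup_fixedField] at hk h3
  rw [← hk, ← h3, ← hK] at hineq
  rw [pow_two] at hK2
  rw [← hK2] at hineq
  by_cases h0 : ((splittingType K' p).filter (· ∣ 2)).sum = 0
  · rw [if_pos h0]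
    split_ifs at hineq <;> omega
  · rw [if_neg h0]
    have hc : ¬ (6 * (splittingType K' p).count 1 = 0 ∧
        6 * ((splittingType K' p).filter (· ∣ 2)).sum = 0) := fun h => h0 (by omega)
    rw [if_neg hc] at hineq
    omega

end S4

end Summit.QuantumAdvantage.QuantumAdvantage.Theorems.DegreeOnePrimesEscape

end
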